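import Literature.MathematicalPhysics.QuantumFieldTheory.Balaban1983to89.B2Ineq339RegularFieldConcrete
import Literature.MathematicalPhysics.QuantumFieldTheory.Balaban1983to89.B2Prop31Thresholds

/-!
# `Balaban1983to89.B2Ineq339RegularFieldThresholds` — [Balaban1982Higgs2] §3.B p. 591 with (3.15) p. 586, (2.98) p. 577 and
Prop. 3.1 (3.26) p. 589: **(3.39) AT A REGULAR NON-ZERO `Ã^ε` WITH BOTH ARITHMETIC HYPOTHESES OF `ineq339_regular` DISCHARGED
FROM THE PRINTED THRESHOLDS** — the KNIT of this seat's `B2Ineq339RegularFieldConcrete.ineq339_regular` (gen 7, p308066) with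
p23's `B2Prop31Thresholds` (gen 10, p309542): taking the regularity modulus of `Ã^ε` on `Bᵏ(Λ_k)` to be the printed-shape
`δ_k = c_A·ε·(Lᵏε)^{−d/2}p(Lᵏε)` ((2.98) in physical units, `deltaReg`) and the sup-restriction of (3.15)₂ to be
`Ψ_k = c_φλ^{−1/4}(Lᵏε)^{−d/4}p(Lᵏε)` (`thrφ`), the smallness hypothesis `hsmall` of (3.29)/(3.35) IS p23's `small_of_thresholds`
(stopping scale `Lᴷε ≤ ε₀`, `SmallEps`) and the uniform error-density hypothesis `hdens` of (3.39) IS `(γ₀/4)·`p23's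
`err_le_of_thresholds` (`≤ (γ₀/4)·Mconst·(Lᵏε)^{κ₀} ≤ (γ₀/4)·Mconst`, any `0 ≤ κ₀ < 2 − d/2`, `d ≤ 3`); so (3.39) at a regular
`Ã^ε` holds with the printed `exp(O(1)Σ_k|Λ_k|)`, `O(1) = ½N log 2 + (γ₀/4)·Mconst`, and NO arithmetic side condition left

statement-level skeleton of published theorems with citation tags; proofs where landed; nothing here is a claim about the Yang–Mills mass gap

CITATION HEADER.  T. Bałaban, *(Higgs)₂,₃ quantum fields in a finite volume. II. An upper bound*, Commun. Math. Phys. **86**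
(1982) 555–594 [Balaban1982Higgs2] (PDF held `paper:balaban1982-cmp86-higgs23-ii`, journal page = PDF page + 554; pp. 586,
589–591 read on the text layer `p0032.txt`, `p0035.txt`–`p0037.txt` and the ×2 renders
`run/shared/lean/pub/pub-balaban/b2b-balaban-ref1/pages/1982-cmp86-higgs23-II/1982-cmp86-higgs23-II-p032/p035/p036/p037-x2.png`).
Cell `lit-balaban` (HOME `run/shared/lean/pub/lit-balaban/`), Phase-2 proof seat **p15** gen 7 (unit `lit-balaban-p15-g7`);
SKELETON rows **B2.Eq3.32** ((3.35)/(3.39)) and **B2.Prop3.1** (owner r02, second reader r14, referee ref-4); cell GAPS G-B2-07 (ix)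
items (d3) (this seat's `B2Ineq339RegularFieldModuli` p308754 and p23's `B2Prop31Thresholds` p309542 — the two (d3) landings are
here made ONE statement).  PRECEDENTS BY NAME: `B2Ineq339RegularFieldConcrete.ineq339_regular`, `B2Prop31Thresholds.{Consts, deltaReg,
thrφ, SmallEps, small_of_thresholds, Mconst, err_le_of_thresholds}`, `B2Prop31ZeroFieldConcrete.mesh_le_mesh`.

WHAT IS PRINTED.  p. 591: *"Now let us estimate the last sum in the curly bracket using (3.26). We get Σ_{k=1}^{K} O(1)|Λ_k|,
thus [(3.39)] (3.22) ≦ Π_{j=0}^{K−1} ζ′_j … exp(O(1) Σ_{k=0}^{K} |Λ_k|)"*; p. 589 Prop. 3.1: *"… − E₀ − O((Lᵏε)^{κ₀})|Λ_k| with κ₀ > 0"*;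
p. 586 (3.15): the restrictions *"|φ′_k| ≦ O(1)λ(Lᵏε)^{−1/4}p(Lᵏε)"* on `Λ₋₁^{(k−1)′} ∩ Λ₅^{(k)c}`; p. 577 (2.98): the regularity of `Ã^ε`;
p. 582: the stopping scale `Lᴷε ≦ ε₀`. [cite: Balaban1982Higgs2, (3.39) p.591, Prop. 3.1 (3.26) p.589, (3.15) p.586, (2.98) p.577, p.582]

CONTENTS.
§1 `mesh_eq_pow_mul_eps` (`Lᵏ·ε = Lᵏε`), `deltaReg_nonneg`, **`small_of_thresholds_level`** (the `hsmall` of `ineq335_regular`/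
   `ineq339_regular` at level `j`, scale `k = j+1 ≤ K`, from `SmallEps` and `Lᴷε ≤ ε₀`), **`errDensity_le_of_thresholds`** (the (3.39)
   error density at the printed thresholds `= (γ₀/4)·(64d³e²(Lᵏ)²δ_k²·Ψ_k²(Lᵏε)^d) ≤ (γ₀/4)·Mconst·(Lᵏε)^{κ₀}`, printed shape) and
   **`errDensity_le_of_thresholds_uniform`** (`≤ (γ₀/4)·Mconst`, the `hdens` of `ineq339_regular`).
§2 **`ineq339_regular_thresholds`**: (3.22) ⇒ (3.39) at a regular `Ã^ε ≠ 0` whose modulus on `Bᵏ(Λ_k)` is `deltaReg` and whose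
   sup-restriction is `thrφ` — `ineq339_regular` with `hsmall` AND `hdens` discharged; constant `O(1) = ½N log 2 + (γ₀/4)·Mconst Γ d κ₀`.
HONEST SCOPE.  (i) As in the parent files: ONE fixed configuration `A : VecField P 0` read as `Ã^ε`, its regularity on the pieces
`pieceF R j` and the sup-restriction `‖φ_j‖ ≤ Ψ_j` on `Λ_j` are HYPOTHESES in the printed threshold SHAPE (their derivation from the
characteristic functions of (3.21) through the cut-offs θ is p23's `B2Eq32FieldRegularity` p309492 / `B2Prop31PrintedRestrictions`,
not imported here); `Γ.e = C.e` identifies p23's coupling constant with the cell's `ChargeData`.  (ii) `κ₀` is any exponent in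
`[0, 2 − d/2)` (print: *"κ₀ > 0"*; (3.39) uses only boundedness — pub-balaban GAPS G-pv07-1 CLARIFICATION).  (iii) `d ≤ 3` (the papers'
`d = 2, 3`).  (iv) Theorems only; no definition, no `Prop`-valued fact.  Value = the §3.B scalar chain at a regular external field
now carries no residual arithmetic hypothesis; NOT summit progress.
-/

noncomputable section

open MeasureTheory Finset Function Real
open scoped ENNReal BigOperators

namespace Literature.MathematicalPhysics.QuantumFieldTheory.Balaban1983to89.B2Ineq339RegularFieldThresholds

open Literature.MathematicalPhysics.QuantumFieldTheory.Balaban1983to89.B2Ineq338Diamagnetic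
open Literature.MathematicalPhysics.QuantumFieldTheory.Balaban1983to89.B2Eq337ScalarIntegration
open Literature.MathematicalPhysics.QuantumFieldTheory.Balaban1983to89.B2Eq325ConcreteSchur
open Literature.MathematicalPhysics.QuantumFieldTheory.Balaban1983to89.B2Eq328ConcretePieces
open Literature.MathematicalPhysics.QuantumFieldTheory.Balaban1983to89.B2Ineq339Gathering
open Literature.MathematicalPhysics.QuantumFieldTheory.Balaban1983to89.B2Eq337LastIntegrations
open Literature.MathematicalPhysics.QuantumFieldTheory.Balaban1983to89.B2Ineq335Exceptions
open Literature.MathematicalPhysics.QuantumFieldTheory.Balaban1983to89.B2Ineq335Printed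
open Literature.MathematicalPhysics.QuantumFieldTheory.Balaban1983to89.B2Ineq335ZeroFieldConcrete
open Literature.MathematicalPhysics.QuantumFieldTheory.Balaban1983to89.B2Ineq335RegularFieldConcrete
open Literature.MathematicalPhysics.QuantumFieldTheory.Balaban1983to89.B2Ineq339RegularFieldConcrete
open Literature.MathematicalPhysics.QuantumFieldTheory.Balaban1983to89.B2Prop31Thresholds

variable {P : HiggsLattice.Params} {N K : ℕ}

/-! ## §1  The two arithmetic hypotheses of `ineq339_regular` at the printed thresholds -/

section Count

variable (P)

/-- `Lᵏ·ε = Lᵏε` — the cell's `mesh` IS p23's `s = ℓ·ε` with `ℓ = Lᵏ` ((1.19) p. 607 of part I). [cite: Balaban1982Higgs1, (1.19) p.607] -/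
theorem mesh_eq_pow_mul_eps (k : ℕ) : ((P.L : ℝ) ^ k) * P.ε = P.mesh k := by
  rw [HiggsLattice.Params.mesh]

variable {P}

/-- The printed-shape regularity modulus `δ_k = c_A·ε·s^{−d/2}p(s)` is non-negative on `0 < s ≤ 1` (`c_A ≥ 0`, `ε > 0`, `p(s) ≥ 0`).
[cite: Balaban1982Higgs2, (2.98) p.577] -/
theorem deltaReg_nonneg {Γ : B2Prop31Thresholds.Consts} (h : Γ.Valid) (d : ℕ) {ε s : ℝ} (hε : 0 ≤ ε) (hs : 0 < s) (hs1 : s ≤ 1) :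
    0 ≤ deltaReg Γ d ε s := by
  unfold deltaReg
  have h1 : 0 ≤ Γ.cA := B2Prop31Thresholds.Consts.cA_nonneg h
  have h2 : 0 ≤ s ^ (-(d : ℝ) / 2) := Real.rpow_nonneg hs.le _
  have h3 : 0 ≤ B2.pFn Γ.b₀ Γ.p s := pFn_nonneg' h hs hs1
  exact mul_nonneg (mul_nonneg (mul_nonneg h1 hε) h2) h3

variable (C : HiggsLattice.ChargeData N)

/-- **The smallness hypothesis `hsmall` of (3.29)/(3.35)/(3.39) at level `j` (scale `k = j+1 ≤ K`) FROM THE THRESHOLDS**: with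
`δ_k = deltaReg` and the stopping scale `Lᴷε ≤ ε₀` under `SmallEps` (*"for e(Lᵏε) sufficiently small"*),
`8d⁴Lᵈe²(Lᵏε)²(Lᵏ)²δ_k² ≤ ½` — p23's `small_of_thresholds` read in the cell's `mesh` currency.
[cite: Balaban1982Higgs2, (3.29) p.590, p.582] [cite: Balaban1983RegularityDecay, Prop. 3.1′ p.574] -/
theorem small_of_thresholds_level {Γ : B2Prop31Thresholds.Consts} (h : Γ.Valid) (he : Γ.e = C.e) (hd : P.d ≤ 3) (hsm : SmallEps P.d P.L Γ)
    (hε0 : P.mesh K ≤ Γ.ε₀) (j : Fin K) :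
    8 * (P.d : ℝ) ^ 4 * (P.L : ℝ) ^ P.d * C.e ^ 2 * P.mesh (j.val + 1) ^ 2 *
      ((P.L : ℝ) ^ (j.val + 1)) ^ 2 * deltaReg Γ P.d P.ε (P.mesh (j.val + 1)) ^ 2 ≤ 1 / 2 := by
  have hjK : P.mesh (j.val + 1) ≤ Γ.ε₀ :=
    (B2Prop31ZeroFieldConcrete.mesh_le_mesh (Nat.succ_le_of_lt j.isLt)).trans hε0
  have h0 := small_of_thresholds h hd hsm (P.mesh_pos (j.val + 1)) hjK (mesh_eq_pow_mul_eps P (j.val + 1))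
  rw [he] at h0
  exact h0

/-- **The (3.39) error density at the printed thresholds, printed shape**: at scale `k = j+1` with `Lᵏε ≤ 1`, `d` arbitrary,
`0 ≤ γ₀`, any `κ₀ < 2 − d/2`:
`16γ₀d³e²(Lᵏ)²δ_k²·(Ψ_k²(Lᵏε)^d) = (γ₀/4)·[64d³e²(Lᵏ)²δ_k²·(Ψ_k²(Lᵏε)^d)] ≤ (γ₀/4)·Mconst·(Lᵏε)^{κ₀}` for `δ_k = deltaReg`, `Ψ_k = thrφ`
— `(γ₀/4)×` p23's `err_le_of_thresholds` (the printed `O((Lᵏε)^{κ₀})` of Prop. 3.1 times the `¼` of (3.35) and the `γ₀` of (3.26)).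
[cite: Balaban1982Higgs2, Prop. 3.1 (3.26) p.589, (3.35)–(3.39) p.591] -/
theorem errDensity_le_of_thresholds {Γ : B2Prop31Thresholds.Consts} (h : Γ.Valid) (he : Γ.e = C.e) {κ₀ : ℝ} (hκ : κ₀ < 2 - (P.d : ℝ) / 2)
    {γ₀ : ℝ} (hγ0 : 0 ≤ γ₀) (j : Fin K) (hmesh : P.mesh (j.val + 1) ≤ 1) :
    16 * γ₀ * (P.d : ℝ) ^ 3 * C.e ^ 2 * ((P.L : ℝ) ^ (j.val + 1)) ^ 2 * deltaReg Γ P.d P.ε (P.mesh (j.val + 1)) ^ 2 *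
      (thrφ Γ P.d (P.mesh (j.val + 1)) ^ 2 * P.mesh (j.val + 1) ^ P.d)
      ≤ γ₀ / 4 * (Mconst Γ P.d κ₀ * P.mesh (j.val + 1) ^ κ₀) := by
  have h0 := err_le_of_thresholds h P.d hκ (P.mesh_pos (j.val + 1)) hmesh (mesh_eq_pow_mul_eps P (j.val + 1))
  rw [he] at h0
  have hγ : 0 ≤ γ₀ / 4 := by positivity
  calc 16 * γ₀ * (P.d : ℝ) ^ 3 * C.e ^ 2 * ((P.L : ℝ) ^ (j.val + 1)) ^ 2 * deltaReg Γ P.d P.ε (P.mesh (j.val + 1)) ^ 2 *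
        (thrφ Γ P.d (P.mesh (j.val + 1)) ^ 2 * P.mesh (j.val + 1) ^ P.d)
      = γ₀ / 4 * (64 * (P.d : ℝ) ^ 3 * C.e ^ 2 * ((P.L : ℝ) ^ (j.val + 1)) ^ 2 *
          deltaReg Γ P.d P.ε (P.mesh (j.val + 1)) ^ 2 * (thrφ Γ P.d (P.mesh (j.val + 1)) ^ 2 * P.mesh (j.val + 1) ^ P.d)) := by
        ring
    _ ≤ γ₀ / 4 * (Mconst Γ P.d κ₀ * P.mesh (j.val + 1) ^ κ₀) := mul_le_mul_of_nonneg_left h0 hγ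

/-- **The uniform error density `hdens` of `ineq339_regular` FROM THE THRESHOLDS**: for `0 ≤ κ₀ < 2 − d/2` and `Lᵏε ≤ 1` the
printed-shape bound `(γ₀/4)·Mconst·(Lᵏε)^{κ₀}` is at most `(γ₀/4)·Mconst` — all that (3.39)'s `exp(O(1)Σ|Λ_k|)` uses.
[cite: Balaban1982Higgs2, (3.39) p.591, Prop. 3.1 (3.26) p.589] -/
theorem errDensity_le_of_thresholds_uniform {Γ : B2Prop31Thresholds.Consts} (h : Γ.Valid) (he : Γ.e = C.e) {κ₀ : ℝ} (hκ0 : 0 ≤ κ₀)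
    (hκ : κ₀ < 2 - (P.d : ℝ) / 2) {γ₀ : ℝ} (hγ0 : 0 ≤ γ₀) (j : Fin K) (hmesh : P.mesh (j.val + 1) ≤ 1) :
    16 * γ₀ * (P.d : ℝ) ^ 3 * C.e ^ 2 * ((P.L : ℝ) ^ (j.val + 1)) ^ 2 * deltaReg Γ P.d P.ε (P.mesh (j.val + 1)) ^ 2 *
      (thrφ Γ P.d (P.mesh (j.val + 1)) ^ 2 * P.mesh (j.val + 1) ^ P.d)
      ≤ γ₀ / 4 * Mconst Γ P.d κ₀ := by
  have h1 := errDensity_le_of_thresholds C h he hκ hγ0 j hmesh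
  have hM : 0 ≤ Mconst Γ P.d κ₀ := Mconst_nonneg h P.d κ₀
  have hsκ : P.mesh (j.val + 1) ^ κ₀ ≤ 1 := Real.rpow_le_one (P.mesh_pos _).le hmesh hκ0
  have h2 : Mconst Γ P.d κ₀ * P.mesh (j.val + 1) ^ κ₀ ≤ Mconst Γ P.d κ₀ := by
    calc Mconst Γ P.d κ₀ * P.mesh (j.val + 1) ^ κ₀ ≤ Mconst Γ P.d κ₀ * 1 := mul_le_mul_of_nonneg_left hsκ hM
      _ = Mconst Γ P.d κ₀ := mul_one _
  have hγ : 0 ≤ γ₀ / 4 := by positivity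
  exact h1.trans (mul_le_mul_of_nonneg_left h2 hγ)

end Count

/-! ## §2  (3.39) at a regular `Ã^ε ≠ 0` with the thresholds as printed -/

section Thresholds

variable (R : Regions P K) (C : HiggsLattice.ChargeData N) (A : HiggsLattice.VecField P 0) {a msq : ℝ}
variable {O : ℕ → Type} [∀ i, Fintype (O i)] [∀ i, DecidableEq (O i)]
variable {ι : Fin K → Type*} [∀ j, Fintype (ι j)]

/-- **(3.22) ⇒ (3.39) AT A REGULAR `Ã^ε ≠ 0` WITH THE PRINTED THRESHOLDS** (`d ≤ 3`, stopping scale `Lᴷε ≤ ε₀`, `SmallEps`,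
`0 ≤ κ₀ < 2 − d/2`): for a configuration `A = Ã^ε` whose regularity modulus on the pieces `Bʲ(Λ_j)` is the printed-shape
`δ = deltaReg Γ d ε (Lʲ⁺¹ε)` ((2.98)) and whose kept variables obey the sup-restriction `‖φ_j‖ ≤ thrφ Γ d (Lʲ⁺¹ε)` ((3.15)₂) on `Λ_j`,
the bound (3.39) holds with NO further arithmetic hypothesis:
`((3.22)).toReal ≤ Π_{j<K} ζ′_j · exp(E_{0,s}) · exp((½N log 2 + (γ₀/4)·Mconst Γ d κ₀)·Σ_{k=0}^{K}|Λ_k|)`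
— `B2Ineq339RegularFieldConcrete.ineq339_regular` with `hsmall` := `small_of_thresholds_level` and `hdens` :=
`errDensity_le_of_thresholds_uniform`. [cite: Balaban1982Higgs2, (3.39) p.591, Prop. 3.1 (3.26) p.589, (3.15) p.586, (2.98) p.577, p.582] -/
theorem ineq339_regular_thresholds (hR : Nested R) (hK : K ≤ P.K) {Γ : B2Prop31Thresholds.Consts} (h : Γ.Valid) (he : Γ.e = C.e)
    (hd : P.d ≤ 3) (hsm : SmallEps P.d P.L Γ) (hε0 : P.mesh K ≤ Γ.ε₀) {κ₀ : ℝ} (hκ0 : 0 ≤ κ₀)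
    (hκ : κ₀ < 2 - (P.d : ℝ) / 2) (ha : 0 < a) (hL : 1 < P.L) (hmsq : 0 < msq)
    (hreg : ∀ (j : Fin K), ∀ z ∈ pieceF R j, ∀ μ' ν : Fin P.d,
      |A ⟨z.shift ν, μ'⟩ - A ⟨z, μ'⟩| ≤ deltaReg Γ P.d P.ε (P.mesh (j.val + 1)))
    {γ₀ : ℝ} (hγ0 : 0 ≤ γ₀) (hγB : γ₀ * (8 * P.d + 2 * msq + 4) ≤ a * (1 - ((P.L : ℝ) ^ 2)⁻¹))
    (hγ16 : γ₀ ≤ 1 / 16)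
    {s : ℕ → ℝ} (hs : ∀ j, 0 < s j)
    {c : (j : ℕ) → ((i : ℕ) → Sites R O i → V N) → Sites R O (j + 1) → V N} (hc : ∀ j, Measurable (c j))
    (hcdep : ∀ j i, j + 1 ≤ i → ∀ (x : (i : ℕ) → Sites R O i → V N) (y : Sites R O i → V N),
      c j (update x i y) = c j x)
    {r : ℕ → ℝ} (hr : ∀ j, 4 * (N : ℝ) * Real.log 2 ≤ a * r j)
    {b : ((i : ℕ) → Sites R O i → V N) → ℝ} (hb : ∀ x, 0 ≤ b x ∧ b x ≤ 1)
    (hrestr : ∀ x, b x ≠ 0 → ∀ (j : Fin K) (y : LSite R j),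
      ‖resL R j (cfgOf R (x 0)) y‖ ≤ thrφ Γ P.d (P.mesh (j.val + 1)))
    (w : (j : Fin K) → ι j → ℝ) (hw : ∀ j τ, 0 ≤ w j τ)
    (Q : (j : Fin K) → ι j → Finset (Bnd P)) (hQ : ∀ j τ, Q j τ ⊆ bondSet R j)
    (Pex : (j : Fin K) → ι j → Finset (Sites R O (j + 1)))
    (χQ : (j : Fin K) → ι j → (KSite R → V N) → ℝ) (hχ : ∀ j τ u, χQ j τ u = 0 ∨ χQ j τ u = 1)
    (hlarge : ∀ j τ u, χQ j τ u = 1 → ∀ bb ∈ Q j τ, r j < bondTermA R C A u bb)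
    (x : (i : ℕ) → Sites R O i → V N) :
    (rhs322 (fun i => (volume : Measure (Sites R O i → V N)))
        (fun u => ENNReal.ofReal (Z325 R C a A msq * Real.exp (-(form325 R C a A msq (cfgOf R u) / 2))))
        (fun x => ENNReal.ofReal (b x))
        (gaussLevel (fun j _ => a * s j) c) (fun j τ => ENNReal.ofReal (w j τ))
        (fun j τ u => ENNReal.ofReal (χQ j τ u))
        (fun j τ => excLevel c j (largeFieldSite (Pex j τ) (s j) (r j))) x).toReal
      ≤ (∏ j : Fin K, ∑ τ : ι j, w j τ * Real.exp (-(γ₀ * r j * (Q j τ).card / 4))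
            * Real.exp (-(a * r j / 8)) ^ (Pex j τ).card)
        * Real.exp (E0s P C msq)
        * Real.exp (((N : ℝ) * Real.log 2 / 2 + γ₀ / 4 * Mconst Γ P.d κ₀)
            * ∑ k ∈ Finset.range (K + 1), vol R k) := by
  have hε1 : P.mesh K ≤ 1 := hε0.trans h.ε₀_le_one
  have hmesh : ∀ j : Fin K, P.mesh (j.val + 1) ≤ 1 := fun j =>
    (B2Prop31ZeroFieldConcrete.mesh_le_mesh (Nat.succ_le_of_lt j.isLt)).trans hε1
  have hδ : ∀ j : Fin K, 0 ≤ deltaReg Γ P.d P.ε (P.mesh (j.val + 1)) := fun j =>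
    deltaReg_nonneg h P.d P.hε.le (P.mesh_pos _) (hmesh j)
  have hC₀ : 0 ≤ γ₀ / 4 * Mconst Γ P.d κ₀ := mul_nonneg (by positivity) (Mconst_nonneg h P.d κ₀)
  exact ineq339_regular R C A hR hK hε1 ha hL hmsq (δ := fun j => deltaReg Γ P.d P.ε (P.mesh (j.val + 1))) hδ hreg
    (fun j => small_of_thresholds_level C h he hd hsm hε0 j) hγ0 hγB hγ16
    (fun j => thrφ Γ P.d (P.mesh (j.val + 1))) hC₀
    (fun j => errDensity_le_of_thresholds_uniform C h he hκ0 hκ hγ0 j (hmesh j))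
    hs hc hcdep hr hb hrestr w hw Q hQ Pex χQ hχ hlarge x

end Thresholds

end Literature.MathematicalPhysics.QuantumFieldTheory.Balaban1983to89.B2Ineq339RegularFieldThresholds

end
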